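import Summits.QuantumFields.YangMills.Theorems.F4SubCurvatureDoorMirrorContinuation
import Summits.QuantumFields.YangMills.Theorems.NPointIsotropy.Negative.HyperoctahedralPlane
import HarnessLib

/-!
# Route `F4SubCurvatureDoor`, crux `SubCurvatureClause` ⟨stmt-QuantumFields-23763⟩ — AXIS REDUCTION of the sub-curvature clause

Helper file (`--supports stmt-QuantumFields-23763 --as helper`; free-hands seat `ym-line-frs-p2` g19).  KERNEL-GENERIC, definition-free,
0 sorry, standard axioms.  It proves, letter for letter, the soft stub `AxisReduction` of the crux idea «rp-moebius-ladder» (ideator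
ym-idea-3 g24, HOME `g24/Sketch.lean` :91–99, evidence on ⟨23763⟩): for a kernel `K : ℝ⁴ → ℝ` continuous off `0`, invariant under the signed
permutations of the axes and pointwise OS-positive (for the door's kernels these are tree outputs: `KernelSymmetries`,
✓`pointwise_rp_of_offDiagLimitAlong`), the sub-curvature clause `‖x‖⁸ K(x) → 0` in EVERY direction follows from the clause ON THE TIME AXIS
`t⁸ K(t e₀) → 0` (`t → 0⁺`).

* `axis_nonneg` — `K(s e₀) ≥ 0` for `s ≠ 0` (the `1 × 1` case of pointwise RP at `(s/2) e₀`, plus `x ↦ −x`);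
* `abs_le_axis_of_spatial` — `|K(−t e₀ + w)| ≤ K(−t e₀)` for `t > 0` and spatial `w` (`w₀ = 0`): the `2 × 2` Cauchy–Schwarz of the RP form at
  the points `(t/2) e₀`, `(t/2) e₀ + w`, whose Gram entries are `K(−t e₀)`, `K(−t e₀ ∓ w)`, together with the spatial inversion
  `(x₀, x⃗) ↦ (x₀, −x⃗)` (a signed permutation) identifying the two off-diagonal entries;
* `abs_le_axis` — `|K(y)| ≤ K(|y₀| e₀)` whenever `y₀ ≠ 0`;
* `exists_coord_ge` — some coordinate has modulus `≥ ‖x‖/2`;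
* ★ `axisReduction` — the stub as typed: the coordinate swap `(0 i)` (a signed permutation) moves a maximal coordinate to the time slot, so
  `‖x‖⁸ |K x| ≤ 2⁸ |xᵢ|⁸ K(|xᵢ| e₀) → 0`.

[cite: OsterwalderSeiler1978, §2] (axis domination of reflection-positive lattice/continuum two-point functions); continuity of `K` is part of
the stub's letter but is not used.

HONEST LABEL: a soft, kernel-generic reduction; the crux content (asymptotic freedom ON the axis: `MoebiusRow`, `CrossoverDecay` of the card)
is untouched; ⟨23763⟩, ⟨23036⟩ open; the Yang–Mills mass gap is NOT proved; no summit is proved by a line.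
-/

set_option autoImplicit false

noncomputable section

open scoped BigOperators
open Filter Topology Metric
open Literature.MathematicalPhysics.QuantumLattice (timeReflection timeReflection_apply)
open Summit.QuantumFields.YangMills.Theorems.F4SubCurvatureDoorGlobalReduction (isSignedPerm_neg isSignedPerm_swap swap_apply)
open Summit.QuantumFields.YangMills.Theorems.NPointIsotropy.Negative (E4)

namespace Summit.QuantumFields.YangMills.Theorems.F4SubCurvatureDoorSubCurvatureClauseAxisReduction

section Kernel

variable {K : E4 → ℝ}
  (hinv : ∀ R : E4 ≃ₗᵢ[ℝ] E4,
    (∀ i : Fin 4, ∃ j : Fin 4, R (EuclideanSpace.single i 1) = EuclideanSpace.single j 1 ∨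
      R (EuclideanSpace.single i 1) = -EuclideanSpace.single j 1) → ∀ x : E4, K (R x) = K x)
  (hRP : ∀ (m : ℕ) (x : Fin m → E4) (c : Fin m → ℝ), (∀ i, 0 < x i 0) →
    0 ≤ ∑ i, ∑ j, c i * c j * K (timeReflection 4 (x i) - x j))

include hinv in
/-- `K(−x) = K(x)` (the total inversion is a signed permutation). -/
theorem apply_neg (x : E4) : K (-x) = K x :=
  hinv (LinearIsometryEquiv.neg ℝ) isSignedPerm_neg x

/-- The spatial inversion `(x₀, x⃗) ↦ (x₀, −x⃗)`, i.e. `−θ`, is a signed permutation of the axes. [folklore] -/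
theorem isSignedPerm_spatialInversion :
    ∀ i : Fin 4, ∃ j : Fin 4,
      ((timeReflection 4).trans (LinearIsometryEquiv.neg ℝ)) (EuclideanSpace.single i (1 : ℝ)) = EuclideanSpace.single j 1 ∨
      ((timeReflection 4).trans (LinearIsometryEquiv.neg ℝ)) (EuclideanSpace.single i (1 : ℝ)) = -EuclideanSpace.single j 1 := by
  intro i
  refine ⟨i, ?_⟩
  by_cases hi : i = 0
  · left
    ext j
    simp only [LinearIsometryEquiv.trans_apply, LinearIsometryEquiv.coe_neg, PiLp.neg_apply,
      timeReflection_apply, PiLp.single_apply]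
    subst hi
    by_cases hj : j = 0
    · subst hj; simp
    · simp [hj]
  · right
    ext j
    simp only [LinearIsometryEquiv.trans_apply, LinearIsometryEquiv.coe_neg, PiLp.neg_apply,
      timeReflection_apply, PiLp.single_apply]
    by_cases hj : j = 0
    · subst hj
      have : ¬ ((0 : Fin 4) = i) := fun h => hi h.symm
      simp [this]
    · simp [hj]

include hinv in
/-- `K(p − w) = K(p + w)` for time-axis `p` and spatial `w` (spatial inversion). -/
theorem apply_sub_spatial (t : ℝ) (w : E4) (hw : w 0 = 0) :
    K (EuclideanSpace.single 0 t - w) = K (EuclideanSpace.single 0 t + w) := by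
  have h := hinv _ isSignedPerm_spatialInversion (EuclideanSpace.single 0 t + w)
  rw [← h]
  congr 1
  ext j
  simp only [LinearIsometryEquiv.trans_apply, LinearIsometryEquiv.coe_neg, PiLp.neg_apply,
    timeReflection_apply, PiLp.add_apply, PiLp.sub_apply, PiLp.single_apply]
  by_cases hj : j = 0
  · subst hj; simp [hw]
  · simp [hj]

include hinv hRP in
/-- **`K ≥ 0` on the punctured time axis**: `0 ≤ K(s e₀)` for `s ≠ 0` (`1 × 1` pointwise RP at `(|s|/2) e₀`, then `x ↦ −x`).
[cite: OsterwalderSeiler1978, §2] -/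
theorem axis_nonneg (s : ℝ) (hs : s ≠ 0) : 0 ≤ K (EuclideanSpace.single 0 s) := by
  -- first for negative time: `K(−t e₀) ≥ 0`, `t > 0`
  have hneg : ∀ t : ℝ, 0 < t → 0 ≤ K (EuclideanSpace.single 0 (-t)) := by
    intro t ht
    have h := hRP 1 (fun _ => EuclideanSpace.single 0 (t / 2)) (fun _ => 1) (fun _ => by
      simp only [PiLp.single_apply, if_true]; positivity)
    have hpt : timeReflection 4 (EuclideanSpace.single (0 : Fin 4) (t / 2)) - EuclideanSpace.single 0 (t / 2) =
        EuclideanSpace.single 0 (-t) := by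
      ext j
      simp only [PiLp.sub_apply, timeReflection_apply, PiLp.single_apply]
      by_cases hj : j = 0
      · subst hj; simp; ring
      · simp [hj]
    simpa [hpt] using h
  rcases lt_or_gt_of_ne hs with h | h
  · have := hneg (-s) (by linarith)
    simpa using this
  · have h1 := hneg s h
    have h2 : EuclideanSpace.single (0 : Fin 4) (-s) = -EuclideanSpace.single 0 s := by
      ext j
      simp only [PiLp.single_apply, PiLp.neg_apply]
      split_ifs <;> simp
    rw [h2, apply_neg hinv] at h1
    exact h1

include hinv hRP in
/-- **Axis domination on the negative half space**: `|K(−t e₀ + w)| ≤ K(−t e₀)` for `t > 0` and spatial `w` (`w₀ = 0`) — the `2 × 2`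
Cauchy–Schwarz of the pointwise RP form at `(t/2) e₀`, `(t/2) e₀ + w` with signs `(1, ±1)`, and `K(−t e₀ − w) = K(−t e₀ + w)`.
[cite: OsterwalderSeiler1978, §2] -/
theorem abs_le_axis_of_spatial (t : ℝ) (ht : 0 < t) (w : E4) (hw : w 0 = 0) :
    |K (EuclideanSpace.single 0 (-t) + w)| ≤ K (EuclideanSpace.single 0 (-t)) := by
  set p : E4 := EuclideanSpace.single 0 (-t) with hp
  -- the Gram entries
  set x : Fin 2 → E4 := ![EuclideanSpace.single 0 (t / 2), EuclideanSpace.single 0 (t / 2) + w] with hx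
  have hx0 : ∀ i, 0 < x i 0 := by
    intro i
    fin_cases i
    · simp [hx]; positivity
    · simp [hx, hw]; positivity
  have e00 : timeReflection 4 (x 0) - x 0 = p := by
    ext j
    simp only [hx, hp, Matrix.cons_val_zero, PiLp.sub_apply, timeReflection_apply, PiLp.single_apply]
    by_cases hj : j = 0
    · subst hj; simp; ring
    · simp [hj]
  have e01 : timeReflection 4 (x 0) - x 1 = p - w := by
    ext j
    simp only [hx, hp, Matrix.cons_val_zero, Matrix.cons_val_one, PiLp.sub_apply, PiLp.add_apply,
      timeReflection_apply, PiLp.single_apply]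
    by_cases hj : j = 0
    · subst hj; simp [hw]; ring
    · simp [hj]
  have e10 : timeReflection 4 (x 1) - x 0 = p + w := by
    ext j
    simp only [hx, hp, Matrix.cons_val_zero, Matrix.cons_val_one, PiLp.sub_apply, PiLp.add_apply,
      timeReflection_apply, PiLp.single_apply]
    by_cases hj : j = 0
    · subst hj; simp [hw]; ring
    · simp [hj]
  have e11 : timeReflection 4 (x 1) - x 1 = p := by
    ext j
    simp only [hx, hp, Matrix.cons_val_one, PiLp.sub_apply, timeReflection_apply, PiLp.single_apply]
    by_cases hj : j = 0
    · subst hj; simp [hw]; ring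
    · simp [hj]
  have hsym : K (p - w) = K (p + w) := apply_sub_spatial hinv (-t) w hw
  -- the two sign choices
  have hform : ∀ σ : ℝ, σ = 1 ∨ σ = -1 → 0 ≤ 2 * K p + 2 * σ * K (p + w) := by
    intro σ hσ
    have h := hRP 2 x ![1, σ] hx0
    have hσ2 : σ * σ = 1 := by rcases hσ with h | h <;> subst h <;> norm_num
    simp only [Fin.sum_univ_two, Matrix.cons_val_zero, Matrix.cons_val_one, e00, e01, e10, e11, hsym] at h
    rw [hσ2] at h
    linarith
  have h1 := hform 1 (Or.inl rfl)
  have h2 := hform (-1) (Or.inr rfl)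
  rw [abs_le]
  constructor <;> linarith

include hinv hRP in
/-- **Axis domination**: `|K(y)| ≤ K(|y₀| e₀)` whenever `y₀ ≠ 0`. [cite: OsterwalderSeiler1978, §2] -/
theorem abs_le_axis (y : E4) (hy : y 0 ≠ 0) : |K y| ≤ K (EuclideanSpace.single 0 |y 0|) := by
  -- negative time first
  have hneg : ∀ z : E4, z 0 < 0 → |K z| ≤ K (EuclideanSpace.single 0 |z 0|) := by
    intro z hz
    set w : E4 := z - EuclideanSpace.single 0 (z 0) with hw
    have hw0 : w 0 = 0 := by simp [hw]
    have hz' : EuclideanSpace.single 0 (-(-z 0)) + w = z := by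
      rw [neg_neg, hw]; abel
    have h := abs_le_axis_of_spatial hinv hRP (-z 0) (by linarith) w hw0
    rw [hz', neg_neg] at h
    have h2 : EuclideanSpace.single (0 : Fin 4) (z 0) = -EuclideanSpace.single 0 |z 0| := by
      rw [abs_of_neg hz]
      ext j
      simp only [PiLp.single_apply, PiLp.neg_apply]
      split_ifs <;> simp
    rwa [h2, apply_neg hinv] at h
  rcases lt_or_gt_of_ne hy with h | h
  · exact hneg y h
  · have h1 := hneg (-y) (by simp only [PiLp.neg_apply]; linarith)
    rw [apply_neg hinv] at h1
    simpa only [PiLp.neg_apply, abs_neg] using h1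

end Kernel

/-- Some coordinate carries at least half of the Euclidean norm: `∃ i, ‖x‖ ≤ 2 |xᵢ|`. [folklore] -/
theorem exists_coord_ge (x : E4) : ∃ i : Fin 4, ‖x‖ ≤ 2 * |x i| := by
  obtain ⟨i, -, hi⟩ := Finset.exists_max_image Finset.univ (fun j : Fin 4 => |x j|) Finset.univ_nonempty
  refine ⟨i, ?_⟩
  have hsq : ‖x‖ ^ 2 = ∑ j, (x j) ^ 2 := by
    rw [EuclideanSpace.norm_eq, Real.sq_sqrt (Finset.sum_nonneg fun j _ => by positivity)]
    simp [Real.norm_eq_abs, sq_abs]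
  have hle : ∑ j : Fin 4, (x j) ^ 2 ≤ ∑ _j : Fin 4, (x i) ^ 2 := by
    refine Finset.sum_le_sum fun j hj => ?_
    have := hi j hj
    rw [← sq_abs (x j), ← sq_abs (x i)]
    exact pow_le_pow_left₀ (abs_nonneg _) this 2
  have h4 : ‖x‖ ^ 2 ≤ (2 * |x i|) ^ 2 := by
    rw [hsq]
    refine hle.trans ?_
    simp only [Finset.sum_const, Finset.card_univ, Fintype.card_fin, nsmul_eq_mul]
    rw [← sq_abs (x i)]
    push_cast
    ring_nf
    exact le_rfl
  exact (sq_le_sq₀ (norm_nonneg _) (by positivity)).1 h4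

/-- ★ **AXIS REDUCTION of the sub-curvature clause** — the soft stub `AxisReduction` of the crux idea «rp-moebius-ladder» (ym-idea-3
g24) letter for letter: for a kernel continuous off `0`, invariant under the signed permutations of the axes and pointwise OS-positive,
`t⁸ K(t e₀) → 0` as `t → 0⁺` implies `‖x‖⁸ K(x) → 0` as `x → 0`. [cite: OsterwalderSeiler1978, §2] -/
theorem axisReduction :
    ∀ K : E4 → ℝ, ContinuousOn K {x : E4 | x ≠ 0} →
      (∀ R : E4 ≃ₗᵢ[ℝ] E4,
        (∀ i : Fin 4, ∃ j : Fin 4, R (EuclideanSpace.single i 1) = EuclideanSpace.single j 1 ∨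
          R (EuclideanSpace.single i 1) = -EuclideanSpace.single j 1) → ∀ x : E4, K (R x) = K x) →
      (∀ (m : ℕ) (x : Fin m → E4) (c : Fin m → ℝ), (∀ i, 0 < x i 0) →
        0 ≤ ∑ i, ∑ j, c i * c j * K (timeReflection 4 (x i) - x j)) →
      Tendsto (fun t : ℝ => t ^ 8 * K (EuclideanSpace.single 0 t)) (𝓝[>] 0) (𝓝 0) →
      Tendsto (fun x : E4 => ‖x‖ ^ 8 * K x) (𝓝[≠] 0) (𝓝 0) := by
  intro K _hKc hinv hRP haxis
  rw [Metric.tendsto_nhdsWithin_nhds] at haxis ⊢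
  intro ε hε
  obtain ⟨δ, hδ, hax⟩ := haxis (ε / 256) (by positivity)
  refine ⟨δ, hδ, fun x hx hxd => ?_⟩
  have hx0 : x ≠ 0 := hx
  rw [dist_zero_right] at hxd
  -- a maximal coordinate `i`, moved to the time slot by the swap `(0 i)`
  obtain ⟨i, hi⟩ := exists_coord_ge x
  set s : ℝ := |x i| with hs
  have hs0 : 0 < s := by
    by_contra h
    have h' : s ≤ 0 := not_lt.1 h
    have : ‖x‖ ≤ 0 := hi.trans (by linarith)
    exact hx0 (norm_le_zero_iff.1 this)
  have hsn : s ≤ ‖x‖ := by simpa only [hs, Real.norm_eq_abs] using PiLp.norm_apply_le x i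
  have hsδ : dist s 0 < δ := by
    rw [dist_zero_right, Real.norm_eq_abs, abs_of_pos hs0]
    exact hsn.trans_lt hxd
  have hKs := hax (show s ∈ Set.Ioi (0 : ℝ) from hs0) hsδ
  rw [dist_zero_right, Real.norm_eq_abs, abs_mul, abs_of_nonneg (by positivity : (0 : ℝ) ≤ s ^ 8)] at hKs
  -- `K x = K (S x)` with `(S x)₀ = x i`, hence `|K x| ≤ K (s e₀)`
  set S : E4 ≃ₗᵢ[ℝ] E4 := LinearIsometryEquiv.piLpCongrLeft 2 ℝ ℝ (Equiv.swap (0 : Fin 4) i) with hS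
  have hSx : K (S x) = K x := hinv S (isSignedPerm_swap i) x
  have hS0 : (S x) 0 = x i := by rw [hS, swap_apply, Equiv.swap_apply_left]
  have hxi : x i ≠ 0 := abs_pos.1 hs0
  have hdom : |K x| ≤ K (EuclideanSpace.single 0 s) := by
    have h := abs_le_axis hinv hRP (S x) (by rw [hS0]; exact hxi)
    rwa [hSx, hS0] at h
  have hKpos : 0 ≤ K (EuclideanSpace.single 0 s) := axis_nonneg hinv hRP s hs0.ne'
  -- `‖x‖⁸ |K x| ≤ (2s)⁸ K(s e₀) = 256 · s⁸ K(s e₀) < ε`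
  rw [dist_zero_right, Real.norm_eq_abs, abs_mul, abs_of_nonneg (by positivity : (0 : ℝ) ≤ ‖x‖ ^ 8)]
  have h8 : ‖x‖ ^ 8 ≤ (2 * s) ^ 8 := pow_le_pow_left₀ (norm_nonneg _) hi 8
  calc ‖x‖ ^ 8 * |K x| ≤ (2 * s) ^ 8 * K (EuclideanSpace.single 0 s) :=
        mul_le_mul h8 hdom (abs_nonneg _) (by positivity)
    _ = 256 * (s ^ 8 * K (EuclideanSpace.single 0 s)) := by ring
    _ ≤ 256 * |s ^ 8 * K (EuclideanSpace.single 0 s)| := by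
        refine mul_le_mul_of_nonneg_left (le_abs_self _) (by norm_num)
    _ = 256 * (s ^ 8 * |K (EuclideanSpace.single 0 s)|) := by
        rw [abs_mul, abs_of_nonneg (by positivity : (0 : ℝ) ≤ s ^ 8)]
    _ < 256 * (ε / 256) := by
        refine mul_lt_mul_of_pos_left hKs (by norm_num)
    _ = ε := by ring

end Summit.QuantumFields.YangMills.Theorems.F4SubCurvatureDoorSubCurvatureClauseAxisReduction

end
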